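import Literature.NumberTheory.PAdicHodge.TateAlmostEtaleTeichmuller
import Literature.NumberTheory.PAdicHodge.TateAlmostEtalePolynomialNorms
import Literature.NumberTheory.PAdicHodge.CyclotomicTower
import Mathlib.Analysis.Normed.Module.FiniteDimension
import Mathlib.Topology.Algebra.Group.Pointwise
import HarnessLib

/-!
# The integers of a finite extension of `ℚ_p` are monogenic: `𝒪_Ω = ℤ_p[x]` (Serre III §6 Prop. 12)

Setting of the tree's `PadicBaseField` / `CyclotomicTower`: `F` a `p`-adic field, `K₀ = PadicBase F p hp`
(`≅ ℚ_p`, normed by `F`), `F̄ = NormedAlgClosure F`, and a finite intermediate field `K₀ ⊆ Ω ⊆ F̄`.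
We prove

* `exists_integral_generator` : **there is an integral `x ∈ Ω` such that every integral `z ∈ Ω` is
  `P(x)` for a polynomial `P ∈ K₀[X]` with integral coefficients** (`𝒪_Ω = ℤ_p[x]`), together with
  `eq_one_of_apply_generator_eq` : such an `x` has trivial stabiliser in `Gal(Ω/K₀)`.

This is Serre, *Local Fields* III §6 Prop. 12 for the (automatically separable) residue extension of
`Ω/ℚ_p`, proved along Serre's lines but with the generator of `k^×` and the polynomial
`X^{q−1} − 1` (`TateAlmostEtaleTeichmuller.exists_generator_digits`): (1) `Ω` is a locally compact
non-trivially normed ultrametric field (finite-dimensional over the locally compact complete `K₀`);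
(2) the `ϖ`-adic expansion gives `z ≈ P_M(x)`, `P_M ∈ ℤ[X]`, to any order
(`exists_intPoly_norm_sub_le_pow`); (3) the set `{Σ_{i<N} a_i x^i : a_i ∈ ℤ_p}` (`N = deg minpoly x`,
whose coefficients are integral since all conjugates of `x` are) contains `ℤ[x]`, is compact (image
of `ℤ_p^N`), hence closed, hence contains `z`.  It is the input `hxgen`/`P` of
`TateAlmostEtaleLayer.gauge_gt_of_layer`.  No `sorry`, no definitions (all structures on `Ω` are
built locally inside the proofs).

References: J.-P. Serre, *Local Fields*, Ch. III §6 Prop. 12; Ch. II §4 Prop. 8 [SerreLocalFields1979].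
-/

noncomputable section

open scoped Classical
open Polynomial IntermediateField Metric Filter Topology

namespace Literature.NumberTheory.PAdicHodge.TateAlmostEtale

open ValuativeRel CyclotomicTower
open Literature.NumberTheory.GaloisRepresentations
open Literature.NumberTheory.GaloisRepresentations.IsNonarchimedeanLocalField
open Literature.NumberTheory.GaloisRepresentations.Ultrametric

variable {F : Type} [Field F] [ValuativeRel F] [TopologicalSpace F] [IsNonarchimedeanLocalField F]
  [CharZero F] {p : ℕ} [Fact p.Prime] (hp : valuation F p < 1)

/-! ## `K₀`: compact unit ball, local compactness -/

/-- The closed unit ball of `K₀ = ℚ_p` is compact (it is `ℤ_p`; transported along the isometry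
`K₀ → F` from the tree's `PadicBase.isCompact_image_padicInt`). [cite: SerreLocalFields1979, Ch. II §5 (ℚ_p is locally compact)] -/
theorem isCompact_closedBall_padicBase :
    IsCompact (closedBall (0 : PadicBase F p hp) 1) := by
  letI := nontriviallyNormedField F
  have hemb : Topology.IsEmbedding (algebraMap (PadicBase F p hp) F) :=
    (PadicBase.isometry_algebraMap hp).isEmbedding
  rw [hemb.isCompact_iff]
  have hsub : algebraMap (PadicBase F p hp) F '' closedBall 0 1 =
      Set.range fun z : ℤ_[p] => LocalField.padicRingHom F p hp (z : ℚ_[p]) := by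
    ext y
    constructor
    · rintro ⟨x, hx, rfl⟩
      rw [mem_closedBall, dist_zero_right] at hx
      obtain ⟨z, hz⟩ := PadicBase.mem_image_of_norm_le hp x 0 (by rw [Int.ofNat_zero, neg_zero, zpow_zero]; exact hx)
      refine ⟨z, ?_⟩
      rw [hz, Int.ofNat_zero, neg_zero, zpow_zero, mul_one]
      rfl
    · rintro ⟨z, rfl⟩
      refine ⟨PadicBase.ofPadicInt hp z, ?_, rfl⟩
      rw [mem_closedBall, dist_zero_right]
      exact PadicBase.norm_ofPadicInt_le_one hp z
  rw [hsub]
  exact PadicBase.isCompact_image_padicInt hp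

/-- `K₀` is locally compact. [cite: SerreLocalFields1979, Ch. II §5] -/
theorem locallyCompactSpace_padicBase : LocallyCompactSpace (PadicBase F p hp) :=
  (isCompact_closedBall_padicBase hp).locallyCompactSpace_of_mem_nhds_of_addGroup
    (closedBall_mem_nhds (0 : PadicBase F p hp) one_pos)

/-! ## The layer `Ω` as a locally compact ultrametric field -/

section Layer

variable (Ω : IntermediateField (PadicBase F p hp) (NormedAlgClosure F))

/-- The norm of `Ω ⊆ F̄` is the restriction of that of `F̄` (the unique extension of the absolute value of
`K₀`). [cite: SerreLocalFields1979, Ch. II §2 (uniqueness of the extended absolute value)] -/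
theorem norm_coe_layer (z : Ω) : ‖z‖ = ‖(z : NormedAlgClosure F)‖ := rfl

/-- `Ω` is a normed `K₀`-space (`‖c • z‖ = ‖c‖ ‖z‖`). [cite: SerreLocalFields1979, Ch. II §2 (finite extensions of complete fields)] -/
theorem norm_smul_layer (c : PadicBase F p hp) (z : Ω) : ‖c • z‖ = ‖c‖ * ‖z‖ := by
  rw [norm_coe_layer, norm_coe_layer, Algebra.smul_def]
  push_cast
  rw [show ((algebraMap (PadicBase F p hp) Ω c : Ω) : NormedAlgClosure F) =
      algebraMap (PadicBase F p hp) (NormedAlgClosure F) c from rfl, norm_mul,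
    PadicBase.norm_algebraMap_closure]

/-- `Ω` contains a non-zero element of norm `≠ 1` (the image of `p`): its absolute value is non-trivial.
[cite: SerreLocalFields1979, Ch. II §2 (finite extensions of complete fields)] -/
theorem exists_norm_ne_one_layer : ∃ z : Ω, z ≠ 0 ∧ ‖z‖ ≠ 1 := by
  refine ⟨algebraMap (PadicBase F p hp) Ω (p : PadicBase F p hp), ?_, ?_⟩
  · rw [_root_.map_ne_zero]; exact Nat.cast_ne_zero.mpr (Fact.out : p.Prime).ne_zero
  · rw [norm_coe_layer, show ((algebraMap (PadicBase F p hp) Ω (p : PadicBase F p hp) : Ω) :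
        NormedAlgClosure F) = algebraMap (PadicBase F p hp) (NormedAlgClosure F) p from rfl,
      PadicBase.norm_algebraMap_closure]
    exact (PadicBase.norm_p_lt_one hp).ne

/-- **A finite extension `Ω` of `K₀` inside `F̄` is locally compact** (finite-dimensional over the
locally compact complete field `K₀`; Mathlib `FiniteDimensional.proper`).
[cite: SerreLocalFields1979, Ch. II §5 (finite extensions of ℚ_p are locally compact)] -/
theorem properSpace_layer [FiniteDimensional (PadicBase F p hp) Ω] : ProperSpace Ω := by
  letI : NormedSpace (PadicBase F p hp) Ω := ⟨fun c z => (norm_smul_layer hp Ω c z).le⟩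
  haveI := locallyCompactSpace_padicBase hp
  exact FiniteDimensional.proper (PadicBase F p hp) Ω

/-! ## The minimal polynomial of an integral element has integral coefficients -/

/-- The minimal polynomial over `K₀` of an integral element of `F̄` has integral coefficients (all its
roots are `G₀`-conjugates of the element, hence of the same absolute value); a private variant of the
PAdicHodge cell's `TateAlmostEtale.norm_coeff_minpoly_le_one` (relative version, `TateAlmostEtaleIntegralBases`).
[cite: SerreLocalFields1979, Ch. II §2 Prop. 3 (integrality of the minimal polynomial)] -/
private theorem norm_coeff_minpoly_le_one' {x : NormedAlgClosure F} (hx : ‖x‖ ≤ 1) (j : ℕ) :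
    ‖(minpoly (PadicBase F p hp) x).coeff j‖ ≤ 1 := by
  set m := minpoly (PadicBase F p hp) x with hm
  have hint : IsIntegral (PadicBase F p hp) x := Algebra.IsIntegral.isIntegral x
  have hmonic : m.Monic := minpoly.monic hint
  have hspl : (m.map (algebraMap (PadicBase F p hp) (NormedAlgClosure F))).Splits :=
    IsAlgClosed.splits _
  have hprod := hspl.eq_prod_roots_of_monic (hmonic.map _)
  rw [← PadicBase.norm_algebraMap_closure hp, ← coeff_map, hprod]
  have hroots : ∀ r ∈ (m.map (algebraMap (PadicBase F p hp) (NormedAlgClosure F))).roots,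
      ‖r‖ ≤ 1 := by
    intro r hr
    rw [BaseGaloisGroup.norm_eq_of_mem_aroots hp x r hr]; exact hx
  have h := norm_coeff_prod_X_sub_C_le _ zero_le_one hroots j
  rwa [one_pow] at h

/-! ## The set `ℤ_p[x]_{<N}` and its compactness -/

/-- The image of `ℤ_p^N` under `a ↦ Σ aᵢ xⁱ` is compact (continuity of the finite sum, compactness of
`ℤ_p`). [cite: SerreLocalFields1979, Ch. II §5 (compactness of ℤ_p)] -/
theorem isCompact_image_sum_powers (x : NormedAlgClosure F) (N : ℕ) :
    IsCompact ((fun a : Fin N → PadicBase F p hp =>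
        ∑ i, algebraMap (PadicBase F p hp) (NormedAlgClosure F) (a i) * x ^ (i : ℕ)) ''
      Set.pi Set.univ fun _ => closedBall 0 1) := by
  refine IsCompact.image (isCompact_univ_pi fun _ => isCompact_closedBall_padicBase hp) ?_
  have hcont : Continuous (algebraMap (PadicBase F p hp) (NormedAlgClosure F)) :=
    (AddMonoidHomClass.isometry_of_norm _ (PadicBase.norm_algebraMap_closure hp)).continuous
  exact continuous_finsetSum _ fun i _ => (hcont.comp (continuous_apply i)).mul continuous_const

/-- `P(x)` for `P ∈ K₀[X]` integral of degree `< N` lies in the image of `ℤ_p^N` under `a ↦ Σ aᵢ xⁱ`.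
[cite: SerreLocalFields1979, Ch. III §6 Prop. 12 (A[x] is spanned by 1, x, …, x^{n−1})] -/
theorem aeval_mem_image_sum_powers (x : NormedAlgClosure F) {N : ℕ} {Q : (PadicBase F p hp)[X]}
    (hQN : Q.natDegree < N) (hQ : ∀ j, ‖Q.coeff j‖ ≤ 1) :
    aeval x Q ∈ (fun a : Fin N → PadicBase F p hp =>
        ∑ i, algebraMap (PadicBase F p hp) (NormedAlgClosure F) (a i) * x ^ (i : ℕ)) ''
      Set.pi Set.univ fun _ => closedBall 0 1 := by
  refine ⟨fun i => Q.coeff i, fun i _ => by rw [mem_closedBall, dist_zero_right]; exact hQ i, ?_⟩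
  change ∑ i : Fin N, algebraMap _ _ (Q.coeff i) * x ^ (i : ℕ) = aeval x Q
  rw [aeval_eq_sum_range' hQN, Finset.sum_range (fun i => Q.coeff i • x ^ i)]
  exact Finset.sum_congr rfl fun i _ => (Algebra.smul_def _ _).symm

/-- **`ℤ[x] ⊆ ℤ_p[x]_{<N}`**: if `x ∈ F̄` is integral with minimal polynomial of degree `N` over `K₀`
(whose coefficients are integral), then every `P(x)`, `P ∈ ℤ[X]`, equals `Q(x)` for some `Q ∈ K₀[X]`
with integral coefficients and `deg Q < N` (reduce `x^N` using the monic integral minimal polynomial).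
[cite: SerreLocalFields1979, Ch. III §6 Prop. 12 (A[x] is spanned by 1, x, …, x^{n−1})] -/
theorem exists_reduced_of_intPoly {x : NormedAlgClosure F} (hx : ‖x‖ ≤ 1) (P : ℤ[X]) :
    ∃ Q : (PadicBase F p hp)[X], Q.natDegree < (minpoly (PadicBase F p hp) x).natDegree ∧
      (∀ j, ‖Q.coeff j‖ ≤ 1) ∧ aeval x Q = aeval x P := by
  set K₀ := PadicBase F p hp
  set m := minpoly K₀ x with hm
  set N := m.natDegree with hN
  have hint : IsIntegral K₀ x := Algebra.IsIntegral.isIntegral x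
  have hmonic : m.Monic := minpoly.monic hint
  have hN1 : 1 ≤ N := minpoly.natDegree_pos hint
  have hmc : ∀ j, ‖m.coeff j‖ ≤ 1 := norm_coeff_minpoly_le_one' hp hx
  have hmN : m.coeff N = 1 := by rw [hN]; exact hmonic.coeff_natDegree
  -- the predicate "representable by a reduced integral polynomial"
  let Good : NormedAlgClosure F → Prop := fun s =>
    ∃ Q : K₀[X], Q.natDegree < N ∧ (∀ j, ‖Q.coeff j‖ ≤ 1) ∧ aeval x Q = s
  have h0 : Good 0 := ⟨0, by rw [natDegree_zero]; exact hN1, fun j => by simp, by simp⟩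
  have hadd : ∀ s t, Good s → Good t → Good (s + t) := by
    rintro s t ⟨Q, hQN, hQ, rfl⟩ ⟨Q', hQ'N, hQ', rfl⟩
    refine ⟨Q + Q', lt_of_le_of_lt (natDegree_add_le _ _) (max_lt hQN hQ'N), fun j => ?_,
      by rw [map_add]⟩
    rw [coeff_add]
    exact (IsUltrametricDist.norm_add_le_max _ _).trans (max_le (hQ j) (hQ' j))
  have hsmul : ∀ (c : K₀), ‖c‖ ≤ 1 → ∀ s, Good s → Good (algebraMap K₀ _ c * s) := by
    rintro c hc s ⟨Q, hQN, hQ, rfl⟩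
    refine ⟨C c * Q, lt_of_le_of_lt (natDegree_C_mul_le c Q) hQN, fun j => ?_, by
      rw [map_mul, aeval_C]⟩
    rw [coeff_C_mul, norm_mul]
    exact mul_le_one₀ hc (norm_nonneg _) (hQ j)
  have hmulx : ∀ s, Good s → Good (x * s) := by
    rintro s ⟨Q, hQN, hQ, rfl⟩
    -- `R = X Q − c m`, `c = Q.coeff (N − 1)`
    refine ⟨X * Q - C (Q.coeff (N - 1)) * m, ?_, fun j => ?_, ?_⟩
    · -- degree `< N`
      have hle : (X * Q - C (Q.coeff (N - 1)) * m).natDegree ≤ N - 1 := by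
        rw [natDegree_le_iff_coeff_eq_zero]
        intro j hj
        rw [coeff_sub, coeff_C_mul]
        obtain ⟨j', rfl⟩ : ∃ j', j = j' + 1 := ⟨j - 1, by omega⟩
        rw [coeff_X_mul]
        rcases Nat.lt_or_ge j' N with hj'N | hj'N
        · -- `j' = N - 1`, `j = N`
          have hj' : j' = N - 1 := by omega
          have hjN : j' + 1 = N := by omega
          rw [hjN, hmN, mul_one, hj', sub_self]
        · rw [coeff_eq_zero_of_natDegree_lt (by omega : Q.natDegree < j'),
            coeff_eq_zero_of_natDegree_lt (by omega : m.natDegree < j' + 1), mul_zero, sub_zero]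
      omega
    · rw [coeff_sub, coeff_C_mul]
      refine (norm_sub_le_max' _ _).trans (max_le ?_ ?_)
      · cases j with
        | zero => rw [coeff_X_mul_zero, norm_zero]; exact zero_le_one
        | succ j => rw [coeff_X_mul]; exact hQ j
      · rw [norm_mul]; exact mul_le_one₀ (hQ _) (norm_nonneg _) (hmc j)
    · rw [map_sub, map_mul, map_mul, aeval_X, aeval_C, hm, minpoly.aeval, mul_zero, sub_zero]
  -- powers of `x`, then all of `ℤ[x]`
  have hpow : ∀ k : ℕ, Good (x ^ k) := by
    intro k
    induction k with
    | zero =>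
      exact ⟨1, by rw [natDegree_one]; exact hN1, fun j => by
        rw [coeff_one]; split_ifs <;> simp, by rw [map_one, pow_zero]⟩
    | succ k ih => rw [pow_succ']; exact hmulx _ ih
  have hP : Good (aeval x P) := by
    rw [aeval_eq_sum_range]
    refine Finset.sum_induction _ Good (fun s t hs ht => hadd s t hs ht) h0 fun j _ => ?_
    rw [show (P.coeff j • x ^ j : NormedAlgClosure F) =
        algebraMap K₀ (NormedAlgClosure F) (P.coeff j : K₀) * x ^ j by
      rw [map_intCast, zsmul_eq_mul]]
    exact hsmul _ (IsUltrametricDist.norm_intCast_le_one _ _) _ (hpow j)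
  exact hP

end Layer

/-! ## Monogenicity -/

/-- **The integers of a finite extension of `ℚ_p` are monogenic** (Serre, *Local Fields* III §6
Prop. 12): for a finite intermediate field `K₀ ⊆ Ω ⊆ F̄` there is an integral `x ∈ Ω` such that every
integral `z ∈ Ω` is `P(x)` for some `P ∈ K₀[X]` with integral coefficients (`𝒪_Ω = ℤ_p[x]`).
Proof: Teichmüller digits + uniformizer in `ℤ[x]` give `z ≈ P_M(x)`, `P_M ∈ ℤ[X]`, to any order
(`TateAlmostEtaleTeichmuller`); reduce to degree `< deg minpoly(x)` with integral coefficients; the set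
of such values is compact, hence closed, hence contains `z`.
[cite: SerreLocalFields1979, Ch. III §6 Prop. 12] -/
theorem exists_integral_generator (Ω : IntermediateField (PadicBase F p hp) (NormedAlgClosure F))
    [FiniteDimensional (PadicBase F p hp) Ω] :
    ∃ x : Ω, ‖(x : NormedAlgClosure F)‖ ≤ 1 ∧
      ∀ z : Ω, ‖(z : NormedAlgClosure F)‖ ≤ 1 →
        ∃ P : (PadicBase F p hp)[X], (∀ j, ‖P.coeff j‖ ≤ 1) ∧ aeval x P = z := by
  set K₀ := PadicBase F p hp
  -- `Ω` as a locally compact non-trivially normed ultrametric field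
  letI : NontriviallyNormedField Ω := NontriviallyNormedField.ofNormNeOne (exists_norm_ne_one_layer hp Ω)
  haveI : ProperSpace Ω := properSpace_layer hp Ω
  obtain ⟨ϖ, hϖ⟩ := exists_isUniformizer (F := Ω)
  obtain ⟨x, q, hx1, hq2, hdig, hxq⟩ := exists_generator_digits hϖ
  refine ⟨x, hx1, fun z hz => ?_⟩
  -- approximation by integer polynomials
  set R : ℤ[X] := X ^ (q - 1) - 1 with hR
  have hRx : aeval x R = x ^ (q - 1) - 1 := by rw [hR, map_sub, map_pow, aeval_X, map_one]
  have hR0 : 0 < ‖aeval x R‖ := by rw [hRx, hxq]; exact norm_pos_iff.mpr ϖ.ne_zero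
  have happrox : ∀ M : ℕ, ∃ P : ℤ[X], ‖z - aeval x P‖ ≤ ‖(ϖ : Ω)‖ ^ M := by
    intro M
    have h := exists_intPoly_norm_sub_le_pow (L := Ω) (fun w hw => ?_) R hR0 (fun w hw => ?_) M z hz
    · rwa [hRx, hxq] at h
    · rcases hdig w hw with h | ⟨i, -, hi⟩
      · exact Or.inl h
      · exact Or.inr ⟨i, hi⟩
    · rw [hRx, hxq]; exact hϖ.norm_le_of_norm_lt_one w hw
  -- the compact set `ℤ_p[x]_{<N}` contains all `P(x)`, `P ∈ ℤ[X]`, hence `z`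
  have hSclosed := (isCompact_image_sum_powers hp (x : NormedAlgClosure F)
    (minpoly K₀ (x : NormedAlgClosure F)).natDegree).isClosed
  have hzS : (z : NormedAlgClosure F) ∈ (fun a : Fin (minpoly K₀ (x : NormedAlgClosure F)).natDegree → K₀ =>
      ∑ i, algebraMap K₀ (NormedAlgClosure F) (a i) * (x : NormedAlgClosure F) ^ (i : ℕ)) ''
        Set.pi Set.univ fun _ => closedBall 0 1 := by
    rw [← hSclosed.closure_eq, Metric.mem_closure_iff]
    intro ε hε
    have hϖ1 : ‖(ϖ : Ω)‖ < 1 := hϖ.norm_lt_one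
    obtain ⟨M, hM⟩ := exists_pow_lt_of_lt_one hε hϖ1
    obtain ⟨P, hP⟩ := happrox M
    obtain ⟨Q, hQN, hQ, hQP⟩ := exists_reduced_of_intPoly hp (x := (x : NormedAlgClosure F)) hx1 P
    refine ⟨aeval (x : NormedAlgClosure F) Q, aeval_mem_image_sum_powers hp _ hQN hQ, ?_⟩
    rw [dist_eq_norm, hQP]
    have h2 : aeval ((x : Ω) : NormedAlgClosure F) P = ((aeval x P : Ω) : NormedAlgClosure F) :=
      aeval_algHom_apply ((algebraMap Ω (NormedAlgClosure F)).toIntAlgHom) x P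
    have e : (z : NormedAlgClosure F) - aeval (x : NormedAlgClosure F) P =
        ((z - aeval x P : Ω) : NormedAlgClosure F) := by
      rw [h2]; push_cast; rfl
    rw [e, ← norm_coe_layer]
    exact hP.trans_lt hM
  obtain ⟨a, ha, hsum⟩ := hzS
  refine ⟨∑ i : Fin (minpoly K₀ (x : NormedAlgClosure F)).natDegree, C (a i) * X ^ (i : ℕ),
    fun j => ?_, ?_⟩
  · rw [finsetSum_coeff]
    simp only [coeff_C_mul, coeff_X_pow]
    by_cases hj : j < (minpoly K₀ (x : NormedAlgClosure F)).natDegree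
    · rw [Finset.sum_eq_single (⟨j, hj⟩ : Fin _)]
      · simp only [if_true, mul_one]
        have := ha ⟨j, hj⟩ (Set.mem_univ _)
        rwa [mem_closedBall, dist_zero_right] at this
      · intro i _ hi
        rw [if_neg, mul_zero]
        exact fun h => hi (Fin.ext h.symm)
      · intro h; exact absurd (Finset.mem_univ _) h
    · rw [Finset.sum_eq_zero fun i _ => ?_]
      · rw [norm_zero]; exact zero_le_one
      · rw [if_neg, mul_zero]
        intro h; exact hj (h ▸ i.2)
  · apply Subtype.ext
    rw [← hsum]
    change ((aeval x (∑ i : Fin (minpoly K₀ (x : NormedAlgClosure F)).natDegree,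
      C (a i) * X ^ (i : ℕ)) : Ω) : NormedAlgClosure F) = _
    rw [← IntermediateField.aeval_coe, map_sum]
    exact Finset.sum_congr rfl fun i _ => by rw [map_mul, aeval_C, map_pow, aeval_X]

/-- A generator of the integers has trivial stabiliser in `Gal(Ω/K₀)`: if `𝒪_Ω = ℤ_p[x]` then
`Ω = K₀(x)`, so an automorphism fixing `x` is the identity. [cite: SerreLocalFields1979, Ch. III §6 Prop. 12 (L = K(x))] -/
theorem eq_one_of_apply_generator_eq (Ω : IntermediateField (PadicBase F p hp) (NormedAlgClosure F))
    {x : Ω} (hgen : ∀ z : Ω, ‖(z : NormedAlgClosure F)‖ ≤ 1 →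
      ∃ P : (PadicBase F p hp)[X], (∀ j, ‖P.coeff j‖ ≤ 1) ∧ aeval x P = z)
    (g : Ω ≃ₐ[PadicBase F p hp] Ω) (hg : g x = x) : g = 1 := by
  set K₀ := PadicBase F p hp
  -- every `z ∈ Ω` is `P(x)/p^k`
  have hfix : ∀ z : Ω, ‖(z : NormedAlgClosure F)‖ ≤ 1 → g z = z := by
    intro z hz
    obtain ⟨P, -, rfl⟩ := hgen z hz
    rw [← aeval_algHom_apply, hg]
  refine AlgEquiv.ext fun z => ?_
  -- scale `z` into the integers by a power of `p`
  have hp1 : ‖(p : K₀)‖ < 1 := PadicBase.norm_p_lt_one hp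
  have hp0 : (p : K₀) ≠ 0 := Nat.cast_ne_zero.mpr (Fact.out : p.Prime).ne_zero
  obtain ⟨k, hk⟩ : ∃ k : ℕ, ‖(z : NormedAlgClosure F)‖ * ‖(p : K₀)‖ ^ k ≤ 1 := by
    rcases eq_or_ne z 0 with rfl | hz0
    · exact ⟨0, by simp⟩
    · have hzpos : 0 < ‖(z : NormedAlgClosure F)‖ := norm_pos_iff.mpr (by
        rw [ne_eq, ZeroMemClass.coe_eq_zero]; exact hz0)
      obtain ⟨k, hk⟩ := exists_pow_lt_of_lt_one (inv_pos.mpr hzpos) hp1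
      refine ⟨k, le_of_lt ?_⟩
      calc ‖(z : NormedAlgClosure F)‖ * ‖(p : K₀)‖ ^ k
          < ‖(z : NormedAlgClosure F)‖ * ‖(z : NormedAlgClosure F)‖⁻¹ := mul_lt_mul_of_pos_left hk hzpos
        _ = 1 := mul_inv_cancel₀ hzpos.ne'
  have hzk : ‖((algebraMap K₀ Ω (p : K₀) ^ k * z : Ω) : NormedAlgClosure F)‖ ≤ 1 := by
    have e : ((algebraMap K₀ Ω (p : K₀) ^ k * z : Ω) : NormedAlgClosure F) =
        (algebraMap K₀ (NormedAlgClosure F) (p : K₀)) ^ k * (z : NormedAlgClosure F) := by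
      push_cast; rfl
    rw [e, norm_mul, norm_pow, PadicBase.norm_algebraMap_closure, mul_comm]
    exact hk
  have h := hfix _ hzk
  rw [map_mul, map_pow, AlgEquiv.commutes] at h
  have hpk : (algebraMap K₀ Ω (p : K₀)) ^ k ≠ 0 :=
    pow_ne_zero _ ((_root_.map_ne_zero (algebraMap K₀ Ω)).mpr hp0)
  rw [AlgEquiv.one_apply]
  exact mul_left_cancel₀ hpk h

end Literature.NumberTheory.PAdicHodge.TateAlmostEtale

end
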